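import Literature.AlgebraicGeometry.Resolution.NormalizationInExtension
import Literature.AlgebraicGeometry.Resolution.PCyclicCoverNormalizationSections
import Mathlib.AlgebraicGeometry.Morphisms.SchemeTheoreticallyDominant
import Mathlib.RingTheory.Localization.Integral
import Mathlib.RingTheory.IntegralClosure.IntegrallyClosed
import Mathlib.FieldTheory.PrimitiveElement
import Mathlib.FieldTheory.PurelyInseparable.Basic
import HarnessLib

set_option linter.dupNamespace false -- mandated namespace of this single-conjunct summit

/-!
# Sections of the normalization `W'^L → W'` over an affine open carrying a `p`-th root

Crux `Picover` (stmt-ResolutionOfSingularities-0554), line `giraud-separated-base`, stub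
`sections_normalizationIn_of_root` (wave 5, U2): the cover-side package consumed by the chart
algebra of the local model.

**Setting.** `W'` an integral scheme with function field `K = K(W')`, `L ⊇ K` a field
extension of prime degree `p`, `ι : W'^L = normalizationIn W' L → W'` the normalization of `W'`
in `L` (`Literature/AlgebraicGeometry/Resolution/NormalizationInExtension`), `V = Spec A ⊆ W'` a
non-empty affine open, `a ∈ A`, and `y ∈ L ∖ K` with `y ^ p = a` (the image of `a` in `L`).

**Claim.** `ι⁻¹ V` is affine; `B = Γ(W'^L, ι⁻¹V)` is integrally closed, integral over `A`
with injective structure map `ι^* : A → B`; and there is `t ∈ B` with `t ^ p = ι^* a` such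
that every `z ∈ B` satisfies `ι^*(d) · z = P(t)` for some `d ∈ A ∖ 0` and `P ∈ A[X]`.

**Proof.** `ι` is integral (hence affine) and dominant between integral schemes, which gives
affineness of `ι⁻¹V`, integrality and injectivity of `ι^*`. By Mathlib's description of the
relative normalization (`Scheme.Hom.normalizationObjIso`, `Scheme.Hom.fromNormalization_app`)
and the identification `Γ(Spec L, ξ_L⁻¹ V) ≅ L` over `A` (`extensionIsoSections`,
`fromSpecExtension_app_apply`), `B ≅ integralClosure A L` compatibly with the structure maps;
the latter is integrally closed (`L/K` finite, `K = Frac A`). The element `y` is integral over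
`A` (`X^p - a`), giving `t`. Finally `[L : K] = p` is prime and `y ∉ K`, so `L = K(y) = K[y]`;
writing the image `ζ ∈ L` of `z` as `Q(y)` with `Q ∈ K[X]` and clearing denominators
(`IsLocalization.integerNormalization`) gives `d ζ = P(y)` in `L`, which transports to `B`.
Modelled on `Literature.AlgebraicGeometry.Resolution.sections_normalization_of_generated`.
-/

noncomputable section

open CategoryTheory AlgebraicGeometry TopologicalSpace Polynomial
open Literature.AlgebraicGeometry.Resolution
open scoped nonZeroDivisors IntermediateField

namespace Summit.ResolutionOfSingularities.ResolutionOfSingularities.Theorems.Picover.SectionsNormalizationInRoot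

/-- **An element outside the base field generates an extension of prime degree**: if
`[L : K] = p` is prime and `y ∈ L ∖ K`, then `K[y] = L` (as a `K`-subalgebra), since
`[K(y) : K]` divides `p` and is not `1`. -/
theorem adjoin_singleton_eq_top_of_not_mem_range {K L : Type*} [Field K] [Field L] [Algebra K L]
    {p : ℕ} (hp : p.Prime) (hdeg : Module.finrank K L = p) {y : L}
    (hy : y ∉ (algebraMap K L).range) : Algebra.adjoin K {y} = ⊤ := by
  haveI : FiniteDimensional K L := Module.finite_of_finrank_pos (by rw [hdeg]; exact hp.pos)
  have hyint : IsIntegral K y := IsIntegral.of_finite K y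
  have htop : K⟮y⟯ = ⊤ := by
    have hdvd : Module.finrank K K⟮y⟯ ∣ p := by
      rw [← hdeg]
      exact ⟨Module.finrank K⟮y⟯ L, (Module.finrank_mul_finrank K K⟮y⟯ L).symm⟩
    rcases hp.eq_one_or_self_of_dvd _ hdvd with h1 | h1
    · refine absurd (IntermediateField.finrank_adjoin_simple_eq_one_iff.mp h1) fun hmem => hy ?_
      obtain ⟨x, hx⟩ := IntermediateField.mem_bot.mp hmem
      exact ⟨x, hx⟩
    · refine (Field.primitive_element_iff_minpoly_natDegree_eq K y).mpr ?_
      rw [← IntermediateField.adjoin.finrank hyint, h1, hdeg]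
  exact (IntermediateField.adjoin_simple_eq_top_iff_of_isAlgebraic hyint.isAlgebraic).mp htop

/-- **Sections of `W'^L → W'` over an affine open carrying a `p`-th root** (cover-side package
of the local model of crux `Picover`). For `W'` integral, `L ⊇ K(W')` of prime degree `p`,
`V ⊆ W'` a non-empty affine open, `a ∈ Γ(W', V)` and `y ∈ L ∖ K(W')` with `y ^ p = a`: the
preimage `ι⁻¹V` under `ι : W'^L → W'` is affine, `Γ(W'^L, ι⁻¹V)` is integrally closed, integral
over `Γ(W', V)` with injective structure map, and contains a `p`-th root `t` of `ι^* a` over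
which it is birational: every section `z` has `ι^*(d) z = P(t)` with `d ∈ Γ(W', V) ∖ 0`,
`P ∈ Γ(W', V)[X]`. Registered sub-goal of the crux item (signature verbatim, universe `0`). -/
theorem sections_normalizationIn_of_root : ∀ (p : ℕ) [Fact p.Prime] (W' : Scheme.{0}) [IsIntegral W'] (L : Type) [Field L] [Algebra W'.functionField L] [IsPurelyInseparable W'.functionField L], Module.finrank W'.functionField L = p → ∀ (V : W'.affineOpens) [Nonempty (V : W'.Opens)] (a : Γ(W', (V : W'.Opens))) (y : L), y ∉ (algebraMap W'.functionField L).range → y ^ p = algebraMap W'.functionField L (W'.germToFunctionField (V : W'.Opens) a) → IsAffineOpen (normalizationInι W' L ⁻¹ᵁ (V : W'.Opens)) ∧ IsIntegrallyClosed Γ(normalizationIn W' L, normalizationInι W' L ⁻¹ᵁ (V : W'.Opens)) ∧ ((normalizationInι W' L).app (V : W'.Opens)).hom.IsIntegral ∧ Function.Injective ((normalizationInι W' L).app (V : W'.Opens)) ∧ ∃ t : Γ(normalizationIn W' L, normalizationInι W' L ⁻¹ᵁ (V : W'.Opens)), t ^ p = (normalizationInι W' L).app (V : W'.Opens) a ∧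 ∀ z : Γ(normalizationIn W' L, normalizationInι W' L ⁻¹ᵁ (V : W'.Opens)), ∃ d : Γ(W', (V : W'.Opens)), d ≠ 0 ∧ ∃ P : Γ(W', (V : W'.Opens))[X], (normalizationInι W' L).app (V : W'.Opens) d * z = P.eval₂ ((normalizationInι W' L).app (V : W'.Opens)).hom t := by
  intro p _ W' _ L _ _ _ hdeg V hV a y hy hyp
  have hp : p.Prime := Fact.out
  haveI : FiniteDimensional W'.functionField L :=
    Module.finite_of_finrank_pos (by rw [hdeg]; exact hp.pos)
  have hV' : ((V : W'.Opens) : Set W').Nonempty := by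
    obtain ⟨x⟩ := hV
    exact ⟨x.1, x.2⟩
  -- (1) `ι⁻¹ V` is affine (`ι` is integral, hence affine)
  have haff : IsAffineOpen (normalizationInι W' L ⁻¹ᵁ (V : W'.Opens)) := V.2.preimage _
  -- (3) integrality and (4) injectivity of `ι^*`
  have hint : ((normalizationInι W' L).app (V : W'.Opens)).hom.IsIntegral :=
    (normalizationInι W' L).isIntegral_app V V.2
  haveI : IsSchemeTheoreticallyDominant (normalizationInι W' L) := .of_isDominant _
  have hinj : Function.Injective ((normalizationInι W' L).app (V : W'.Opens)) :=
    (normalizationInι W' L).app_injective V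
  -- the algebras `A = Γ(W', V) → K(W') → L` and `A → Γ(Spec L, ξ_L⁻¹ V)`
  haveI : IsFractionRing Γ(W', V) W'.functionField :=
    functionField_isFractionRing_of_isAffineOpen W' V V.2
  letI algL : Algebra Γ(W', V) L :=
    ((algebraMap W'.functionField L).comp (W'.germToFunctionField V).hom).toAlgebra
  haveI : IsScalarTower Γ(W', V) W'.functionField L :=
    IsScalarTower.of_algebraMap_eq fun _ => rfl
  letI algS : Algebra Γ(W', V) Γ(Spec (.of L), fromSpecExtension W' L ⁻¹ᵁ V) :=
    ((fromSpecExtension W' L).app V).hom.toAlgebra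
  -- `B ≅ integralClosure A L`, compatibly with the structure maps
  -- (adapted from `Literature.AlgebraicGeometry.Resolution.sections_normalization_of_generated`)
  let e : L ≃ₐ[Γ(W', V)] Γ(Spec (.of L), fromSpecExtension W' L ⁻¹ᵁ V) :=
    { (extensionIsoSections (X := W') (L := L) hV').commRingCatIsoToRingEquiv with
      commutes' := fun a => (fromSpecExtension_app_apply (X := W') (L := L) hV' a).symm }
  let e₁ : integralClosure Γ(W', V) L ≃ₐ[Γ(W', V)]
      integralClosure Γ(W', V) Γ(Spec (.of L), fromSpecExtension W' L ⁻¹ᵁ V) :=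
    e.mapIntegralClosure
  let e₂ : Γ(normalizationIn W' L, normalizationInι W' L ⁻¹ᵁ (V : W'.Opens)) ≃+*
      integralClosure Γ(W', V) Γ(Spec (.of L), fromSpecExtension W' L ⁻¹ᵁ V) :=
    ((fromSpecExtension W' L).normalizationObjIso V.2).commRingCatIsoToRingEquiv
  let E : integralClosure Γ(W', V) L ≃+*
      Γ(normalizationIn W' L, normalizationInι W' L ⁻¹ᵁ (V : W'.Opens)) :=
    e₁.toRingEquiv.trans e₂.symm
  have hEalg : ∀ x : Γ(W', V),
      E (algebraMap _ _ x) = (normalizationInι W' L).app (V : W'.Opens) x := by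
    intro x
    change e₂.symm (e₁ (algebraMap _ _ x)) = _
    rw [AlgEquiv.commutes]
    have h := (fromSpecExtension W' L).fromNormalization_app V.2
    change _ = (fromSpecExtension W' L).fromNormalization.app _ x
    rw [h]
    rfl
  have hEcomp : E.toRingHom.comp (algebraMap Γ(W', V) (integralClosure Γ(W', V) L)) =
      ((normalizationInι W' L).app (V : W'.Opens)).hom :=
    RingHom.ext hEalg
  -- (2) integrally closed
  haveI : IsIntegrallyClosed (integralClosure Γ(W', V) L) :=
    integralClosure.isIntegrallyClosedOfFiniteExtension (K := W'.functionField) (L := L)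
  have hic :
      IsIntegrallyClosed Γ(normalizationIn W' L, normalizationInι W' L ⁻¹ᵁ (V : W'.Opens)) :=
    IsIntegrallyClosed.of_equiv E
  -- (5) the `p`-th root `t` of `ι^* a`: the image of `y`, which is integral over `A`
  have hyint : IsIntegral Γ(W', V) y := by
    refine ⟨X ^ p - C a, monic_X_pow_sub_C _ hp.ne_zero, ?_⟩
    rw [eval₂_sub, eval₂_X_pow, eval₂_C, hyp, RingHom.algebraMap_toAlgebra,
      RingHom.comp_apply, sub_self]
  refine ⟨haff, hic, hint, hinj, E ⟨y, hyint⟩, ?_, fun z => ?_⟩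
  · rw [← map_pow, ← hEalg]
    congr 1
    exact Subtype.ext hyp
  -- (6) birational generation: `L = K[y]`, then clear denominators
  set ζ : integralClosure Γ(W', V) L := E.symm z with hζ
  obtain ⟨Q, hQ⟩ : ∃ Q : (W'.functionField)[X], aeval y Q = (ζ : L) := by
    have hmem : (ζ : L) ∈ Algebra.adjoin W'.functionField {y} := by
      rw [adjoin_singleton_eq_top_of_not_mem_range hp hdeg hy]
      exact Algebra.mem_top
    rwa [Algebra.adjoin_singleton_eq_range_aeval] at hmem
  obtain ⟨d, hd, hdQ⟩ := IsLocalization.integerNormalization_spec (Γ(W', V))⁰ Q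
  set P : Γ(W', V)[X] := IsLocalization.integerNormalization (Γ(W', V))⁰ Q with hP
  refine ⟨d, nonZeroDivisors.ne_zero hd, P, ?_⟩
  -- in `L`: `d ζ = P(y)`
  have hL : algebraMap Γ(W', V) L d * (ζ : L) = aeval y P := by
    rw [← aeval_map_algebraMap W'.functionField y P, hdQ,
      ← IsScalarTower.algebraMap_smul W'.functionField d Q, map_smul, hQ, Algebra.smul_def,
      ← IsScalarTower.algebraMap_apply]
  -- in `integralClosure A L`
  have hIC : algebraMap Γ(W', V) (integralClosure Γ(W', V) L) d * ζ =
      aeval (⟨y, hyint⟩ : integralClosure Γ(W', V) L) P := by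
    apply Subtype.ext
    change algebraMap Γ(W', V) L d * (ζ : L) =
      ((aeval (⟨y, hyint⟩ : integralClosure Γ(W', V) L) P : integralClosure Γ(W', V) L) : L)
    rw [hL, ← Subalgebra.aeval_coe]
  -- transport to `B` along `E`
  have hB := congrArg E hIC
  rw [map_mul, hEalg, hζ, RingEquiv.apply_symm_apply] at hB
  rw [hB, aeval_def, ← hEcomp]
  exact Polynomial.hom_eval₂ P _ E.toRingHom _

end Summit.ResolutionOfSingularities.ResolutionOfSingularities.Theorems.Picover.SectionsNormalizationInRoot

end
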